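import Mathlib
import Literature.MathematicalPhysics.QuantumFieldTheory.MagnenRivasseauSeneor1993.MRS93AnisotropicSlicing
import HarnessLib

/-!
# Magnen–Rivasseau–Sénéor, *Construction of YM₄ with an infrared cutoff* (CMP 155, 1993), Sect. IV p.355, (IV.6)–(IV.9):
# the decomposition of `F²` over the core small field ∕ large field ∕ boundary regions «in a way which respects the
# positivity of each piece» — the printed localisation TYPED as definitions with bodies, its positivity and the
# resummation identity PROVED for bounded operators on a Hilbert space

statement-level skeleton of published definitions with citation tags; the operator algebra behind one printed sentence
kernel-checked; nothing here is a claim about the Yang–Mills mass gap, about continuum YM₄ on T⁴ without infrared cutoff,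
or about the Clay problem — and nothing of Magnen–Rivasseau–Sénéor's analysis is asserted

**Citation header (reproduction of PUBLISHED work).** J. Magnen, V. Rivasseau, R. Sénéor, *Construction of YM₄ with an
infrared cutoff*, Commun. Math. Phys. **155** (1993) 325–383 [MagnenRivasseauSeneor1993], Sect. IV «The Propagators for Large
and Small Fields» (heading p.352), p.355 [PDF 31] tl.3–7, tl.14–27 and displays (IV.6)–(IV.9) (read on the decoded page image
`run/shared/lean/pub/lit-balaban/inprint/lit-balaban-p14/renders-cmp155/p31_full_s6.png`; loci `p.NNN tl.nn` = journal page ∕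
text-layer line of the held scan `paper:magnen1993-cmp155-mrs-ym4-infrared-cutoff`, PDF page = journal page − 324); (II.15)
p.331 [PDF 7] and (II.21a∕b) p.335 [PDF 11] for the slices `κ^j`. Cell pub-balaban-gaps (YM blitz, track G3), seat mrs-lit-2
(gen 21); companion record `run/shared/lean/pub/pub-balaban-gaps/g3/MRS-AS-PRINTED-estimates.md` §7 (display concordance:
(IV.7)–(IV.9) were, with (IV.11), the only numbered displays of Sect. IV cited by no Lean file of either seat). Imports
`…MRS93AnisotropicSlicing` (mrs-lit-1; through it `…MRS93StartingAnsatz`) ONLY for §5, the symbols `κ^i` (II.15) ∕ `κ^{i,α}`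
(II.21) whose square roots the print takes; §§1–4 use Mathlib alone.

**What the paper prints (verbatim; p.352 for the programme, p.355 for the displays).**
* p.352 [PDF 28] tl.38–39 (end of the introduction of Sect. IV): *«We use a rather complicated symmetric way to extract them in order
  to preserve positivity as much as possible (positivity is indeed essential for constructive estimates).»*
* p.355 tl.3–7: *«We introduce also a protection corridor around LFR and call ELFR (extended large field region) the region LFR plus
  its corridor. The region complementary to ELFR, called the core small field region CSFR is contained in SFR and protected
  from LFR by the corridor (see Fig. IV.1). The region ELFR–LFR is called the boundary region BR.»*
* p.355 tl.14–19: *«In the boundary region BR it is enough to keep the initial measure dμ₀ and to remark that F², which is treated as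
  an interaction, remains positive. This gives a bad normalization to the boxes of this boundary (of the order of λ^{−O(1)} per
  such box), which is compensated by the excellent small factor for the boxes of LFR (see Lemma II.1) if the width of the
  protection corridors is in λ^{−ε} with ε very small. For a simple example of how to treat such normalization effects we refer
  e.g. to [DMR].»*
* p.355 tl.20–27: *«Now we decompose F² in three pieces in a way which respects the positivity of each piece:
  F²(A′) = F²(A′)_CSFR + F²(A′)_LFR + F²(A′)_BR ,  (IV.6)
  F²(A′)_CSFR ≡ Σ_j Σ_{Δ∈CSFR_j} F_μν (κ^j)^{1∕2} χ_Δ (κ^j)^{1∕2} F_μν ,  (IV.7)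
  F²(A′)_LFR ≡ Σ_j Σ_{Δ∈LFR_j} F_μν (κ^j)^{1∕2} χ_Δ (κ^j)^{1∕2} F_μν ,  (IV.8)
  F²(A′)_BR ≡ Σ_j Σ_{Δ∈BR_j} F_μν (κ^j)^{1∕2} χ_Δ (κ^j)^{1∕2} F_μν .  (IV.9)
  More generally an index like CSFR, LFR, BR etc. is a short notation for a decomposition of the type (IV.6–9).»*
* (II.15) p.331: *«κ^i = κ_i − κ_{i−1} if i ≥ 1; κ⁰ = κ₀»*; (II.21a∕b) p.335: the anisotropic slices `κ^j`, `j = (i, α) ∈ 𝐏`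
  (typed by mrs-lit-1: `Ansatz.sliceCutoff`, `Ansatz.anisoSlice`, with `sliceCutoff_nonneg`, `anisoSlice_nonneg`,
  `sum_sliceCutoff`).

**What is typed here (definitions with bodies) and what is PROVED (kernel; zero `sorry`, zero named facts).**
* §1 the three printed labels `Region.CSFR ∕ .LFR ∕ .BR` and the printed rule tl.3–7 assigning a box to a region from the pair
  (LFR, ELFR): `regionOf LFR ELFR Δ` (= LFR on LFR, BR on ELFR ∖ LFR, CSFR off ELFR), with `regionOf_eq_LFR_iff`,
  `regionOf_eq_BR_iff` («ELFR–LFR is called the boundary region BR»), `regionOf_eq_CSFR_iff` («complementary to ELFR»).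
* §2 the printed CELL OPERATOR `(κ^j)^{1∕2} χ_Δ (κ^j)^{1∕2}` for bounded operators on a Hilbert space over `𝕜 = ℝ` or `ℂ`:
  `cellOp S χ = S χ S`; PROVED: if `S` is self-adjoint and `χ` is a positive operator then `cellOp S χ` is a positive operator
  (`isPositive_cellOp`, Mathlib's `IsPositive.conj_adjoint`), its form is `⟪F, SχS F⟫ = ⟪SF, χ(SF)⟫` (`inner_cellOp`) and is
  `≥ 0` (`inner_cellOp_nonneg`).
* §3 the data of (IV.7)–(IV.9) as a structure `SliceLocalization` — finitely many slices `j` (in the paper `j ∈ 𝐏`, finite at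
  fixed cutoff), for each `j` the finite set `boxes j` of boxes of the lattice `𝐃_j` (finite volume), the self-adjoint operators
  `sqrtSlice j` = `(κ^j)^{1∕2}`, the positive operators `chi Δ` = `χ_Δ` with `Σ_{Δ∈𝐃_j} χ_Δ = 1` (the boxes of `𝐃_j` tile `Λ`) —
  and, for ANY labelling `reg j Δ` of the cells by a finite label set («More generally an index like CSFR, LFR, BR etc.»), the
  piece `pieceOp reg X = Σ_j Σ_{Δ∈𝐃_j, reg j Δ = X} (κ^j)^{1∕2} χ_Δ (κ^j)^{1∕2}`; (IV.7) `F2CSFR`, (IV.8) `F2LFR`, (IV.9) `F2BR` are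
  its three printed instances. PROVED: **`isPositive_pieceOp`** ∕ `inner_pieceOp_nonneg` and the three instances
  `isPositive_F2CSFR ∕ _F2LFR ∕ _F2BR` — «respects the positivity of each piece»; **`sum_pieceOp`**: `Σ_X pieceOp reg X = Σ_j κ^j`
  with `κ^j := (κ^j)^{1∕2}(κ^j)^{1∕2}` (`slice j`), for every finite label set — the «more generally» sentence; **`display_IV6`**:
  `F2CSFR + F2LFR + F2BR = Σ_j κ^j` (operators) and `inner_display_IV6`: `⟪F, (F2CSFR + F2LFR + F2BR)F⟫ = Σ_j ‖(κ^j)^{1∕2}F‖²`;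
  `pieceOp_le_total` (each piece is below the total in the Loewner order); and the sentence-level (IV.6) «F²(A′) = …» in the
  form `display_IV6_of_carried`: `⟪F, F⟫ = ⟪F, F2CSFR F⟫ + ⟪F, F2LFR F⟫ + ⟪F, F2BR F⟫` WHENEVER `(Σ_j κ^j)F = F`, with the general
  defect `⟪F, F⟫ − (the three forms) = ⟪F, (1 − Σ_j κ^j)F⟫` exhibited (`display_IV6_defect`) — see Reading (γ).
* §4 WHY THE SQUARE ROOTS (kernel counterexample, `2 × 2` rational matrices): with `κ` the orthogonal projection on `(1,1)` (its
  own square root) and `χ` the coordinate projection `diag(1,0)`, both positive, the NAIVE localisation `χκ` and its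
  symmetrisation `(χκ + κχ)∕2` have the value `−1∕2 < 0` on `v = (1, −2)` (`naive_form_neg`, `naiveSymm_form_neg`), whereas the
  printed sandwich `κ^{1∕2}χκ^{1∕2} = κχκ` has form `(v₀ + v₁)²∕4 ≥ 0` (`sandwich_form_nonneg`): momentum slices and box
  indicators do not commute, and only the symmetric placement of (IV.7)–(IV.9) keeps each piece positive.
* §5 the symbols: `Real.sqrt (κ^i(r))² = κ^i(r)` and `Real.sqrt (κ^{i,α}(r, r₀))² = κ^{i,α}(r, r₀)` from the tree's nonnegativity of
  the slices (`sqrt_sliceCutoff_sq`, `sqrt_anisoSlice_sq`), and `Σ_{i≤ρ} (Real.sqrt κ^i)² = κ_ρ` (`sum_sqrt_sliceCutoff_sq`, the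
  telescoping (II.15)) — the scalar content of «(κ^j)^{1∕2}» and of `Σ_j κ^j`.

**Readings (declared).** (α) «positive» ∕ «respects the positivity» = Mathlib's `ContinuousLinearMap.IsPositive` (symmetric with
`0 ≤ ⟪Tx, x⟫`) for the operator between the two `F_μν`'s, hence nonnegativity of each displayed quadratic expression for every
`F`; the sum over `μν` and the trace over colour indices are part of the Hilbert space `E` (any `E`). (β) `(κ^j)^{1∕2}` is READ as
a bounded self-adjoint operator whose square is the slice operator `κ^j` (for the paper's Fourier multipliers: multiplication of
`F̃(p)` by the nonnegative real `(κ^j(p))^{1∕2}`, §5), and `χ_Δ` as a positive operator with `Σ_{Δ∈𝐃_j} χ_Δ = 1` for each `j`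
(for the paper: multiplication by the indicator of the box `Δ`, the boxes of `𝐃_j` partitioning `Λ`); both are hypotheses
(fields of `SliceLocalization`), the file constructs no Fourier multiplier. (γ) In (IV.6) the print writes `F²(A′)` on the left;
summing the right-hand sides of (IV.7)–(IV.9) over ALL cells gives `⟨F, (Σ_j κ^j) F⟩` (`display_IV6`), which is `⟨F, F⟩` exactly
when `Σ_j κ^j` acts as the identity on `F = F_μν(A′)`. Over which slices `j` runs, and whether the curvature of the cut-off
field (quadratic in `A′`, momenta up to twice the cutoff) is reproduced by `Σ_j κ^j` (`= κ_ρ` over `0 ≤ j ≤ ρ` by (II.15);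
`= κ_{ρ₁} − κ₀` over `𝐏` under mrs-lit-1's reading `Ansatz.fieldDecomposition_eq`), the print does not say at this point; the
identity is typed with its right-hand side as printed and the hypothesis `(Σ_j κ^j)F = F` named, the defect exhibited, nothing
adjudicated. (δ) `j` ranges over an arbitrary finite type `J` and the boxes over finite sets: MRS work in a finite volume with
an ultraviolet cutoff, and the index set 𝐏 of the slices (p.334) is finite, so both index sets are finite.

**What is NOT claimed or typed.** (IV.10)–(IV.13) («F²(A′)_CSFR = ((∇_{B′_l})_μ(A′_s)_ν − (∇_{B′_l})_ν(A′_s)_μ)²_CSFR + H(A′_s, B′_l)»,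
«F²(A′)_LFR = (⟨B′_l, p₀²B′_l⟩)_LFR + K(A′_s, B′_l)» with `H`, `K` «terms with at least one …» — descriptions, not formulas); (IV.14)–(IV.16) (typed elsewhere: `…MRS93HomotheticCovariantA27`,
`…MRS93CovariantIntegrationByParts`); the corridor widths `λ^{−ε}`, the «bad normalization … λ^{−O(1)} per such box» and its
compensation by Lemma II.1 (an estimate of the expansion, by reference to [DMR] — not restated in print); the measure `dμ₀`;
any convergence. MRS work at FIXED INFRARED CUTOFF in finite volume: nothing here bears on infinite volume, on a mass gap, or on
Bałaban's lattice programme.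
-/

noncomputable section

open scoped InnerProductSpace ComplexOrder
open Finset

namespace Literature.MathematicalPhysics.QuantumFieldTheory.MagnenRivasseauSeneor1993

namespace PositiveLocalization

/-! ## §1 The three printed regions CSFR ∕ LFR ∕ BR (p.355 tl.3–7) -/

/-- The three printed region labels of Sect. IV: the core small field region, the large field region, the boundary region.
*«More generally an index like CSFR, LFR, BR etc. is a short notation for a decomposition of the type (IV.6–9).»*
[cite: MagnenRivasseauSeneor1993, Sect. IV p.355 tl.3–7, tl.26–27] -/
inductive Region
  /-- «the core small field region CSFR» — the complement of ELFR. -/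
  | CSFR
  /-- «LFR» — the large field region. -/
  | LFR
  /-- «The region ELFR–LFR is called the boundary region BR.» -/
  | BR
  deriving DecidableEq

namespace Region

/-- The three labels form a finite type, enumerated in the printed order CSFR, LFR, BR. [folklore] -/
instance : Fintype Region :=
  ⟨{CSFR, LFR, BR}, fun X => by cases X <;> simp⟩

/-- The label set is `{CSFR, LFR, BR}` — the three pieces of (IV.6). [cite: MagnenRivasseauSeneor1993, Sect. IV (IV.6) p.355] -/
theorem univ_eq : (Finset.univ : Finset Region) = {CSFR, LFR, BR} := rfl

/-- A sum over the three labels is the printed three-term sum of (IV.6).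
[cite: MagnenRivasseauSeneor1993, Sect. IV (IV.6) p.355] -/
theorem sum_univ {M : Type*} [AddCommMonoid M] (f : Region → M) : ∑ X, f X = f CSFR + f LFR + f BR := by
  rw [univ_eq, sum_insert (by simp), sum_insert (by simp), sum_singleton, add_assoc]

end Region

section regions

variable {β : Type*} [DecidableEq β]

/-- p.355 tl.3–7: the region of a box `Δ` given the large field region `LFR` and the extended large field region `ELFR`
(«the region LFR plus its corridor»): `LFR` on `LFR`, `BR` on «ELFR–LFR», `CSFR` on «the region complementary to ELFR».
[cite: MagnenRivasseauSeneor1993, Sect. IV p.355 tl.3–7] -/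
def regionOf (LFR ELFR : Finset β) (Δ : β) : Region :=
  if Δ ∈ LFR then Region.LFR else if Δ ∈ ELFR then Region.BR else Region.CSFR

/-- [cite: MagnenRivasseauSeneor1993, Sect. IV p.355 tl.3–7] -/
theorem regionOf_eq_LFR_iff (LFR ELFR : Finset β) (Δ : β) : regionOf LFR ELFR Δ = Region.LFR ↔ Δ ∈ LFR := by
  unfold regionOf; split_ifs <;> simp_all

/-- «The region ELFR–LFR is called the boundary region BR.» [cite: MagnenRivasseauSeneor1993, Sect. IV p.355 tl.6–7] -/
theorem regionOf_eq_BR_iff (LFR ELFR : Finset β) (Δ : β) : regionOf LFR ELFR Δ = Region.BR ↔ Δ ∈ ELFR \ LFR := by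
  unfold regionOf; split_ifs <;> simp_all

/-- «The region complementary to ELFR, called the core small field region CSFR» (given «ELFR … the region LFR plus its
corridor», i.e. `LFR ⊆ ELFR`). [cite: MagnenRivasseauSeneor1993, Sect. IV p.355 tl.4–5] -/
theorem regionOf_eq_CSFR_iff {LFR ELFR : Finset β} (h : LFR ⊆ ELFR) (Δ : β) :
    regionOf LFR ELFR Δ = Region.CSFR ↔ Δ ∉ ELFR := by
  unfold regionOf
  split_ifs with h1 h2
  · simpa using h h1
  · simpa using h2
  · simpa using h2

end regions

/-! ## §2 The printed cell operator `(κ^j)^{1∕2} χ_Δ (κ^j)^{1∕2}` and its positivity -/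

section cell

variable {𝕜 E : Type*} [RCLike 𝕜] [NormedAddCommGroup E] [InnerProductSpace 𝕜 E]

/-- The operator between the two `F_μν`'s in (IV.7)–(IV.9): `(κ^j)^{1∕2} χ_Δ (κ^j)^{1∕2}`, for `S = (κ^j)^{1∕2}` and `χ = χ_Δ`
bounded operators. [cite: MagnenRivasseauSeneor1993, Sect. IV (IV.7)–(IV.9) p.355] -/
def cellOp (S χ : E →L[𝕜] E) : E →L[𝕜] E := S * χ * S

/-- [cite: MagnenRivasseauSeneor1993, Sect. IV (IV.7) p.355] -/
theorem cellOp_apply (S χ : E →L[𝕜] E) (F : E) : cellOp S χ F = S (χ (S F)) := rfl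

variable [CompleteSpace E]

/-- **The printed placement is positivity-preserving**: for `S = (κ^j)^{1∕2}` self-adjoint and `χ = χ_Δ` a positive operator,
`SχS` is a positive operator. [cite: MagnenRivasseauSeneor1993, Sect. IV p.355 tl.20–21 «in a way which respects the positivity
of each piece»] -/
theorem isPositive_cellOp {S χ : E →L[𝕜] E} (hS : IsSelfAdjoint S) (hχ : χ.IsPositive) : (cellOp S χ).IsPositive := by
  have h := hχ.conj_adjoint S
  rw [hS.adjoint_eq] at h
  rw [cellOp, mul_assoc, ContinuousLinearMap.mul_def, ContinuousLinearMap.mul_def]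
  exact h

/-- The form of the cell: `⟪F, (κ^j)^{1∕2}χ_Δ(κ^j)^{1∕2} F⟫ = ⟪(κ^j)^{1∕2}F, χ_Δ (κ^j)^{1∕2}F⟫` — the box indicator is evaluated
on the SLICED field. [cite: MagnenRivasseauSeneor1993, Sect. IV (IV.7) p.355] -/
theorem inner_cellOp {S : E →L[𝕜] E} (hS : IsSelfAdjoint S) (χ : E →L[𝕜] E) (F : E) :
    ⟪F, cellOp S χ F⟫_𝕜 = ⟪S F, χ (S F)⟫_𝕜 := by
  rw [cellOp_apply, ← ContinuousLinearMap.adjoint_inner_left S (χ (S F)) F, hS.adjoint_eq]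

/-- Each cell contributes a nonnegative amount. [cite: MagnenRivasseauSeneor1993, Sect. IV p.355 tl.20–21] -/
theorem inner_cellOp_nonneg {S χ : E →L[𝕜] E} (hS : IsSelfAdjoint S) (hχ : χ.IsPositive) (F : E) :
    0 ≤ ⟪F, cellOp S χ F⟫_𝕜 :=
  (isPositive_cellOp hS hχ).inner_nonneg_right F

omit [CompleteSpace E] in
/-- Resummation of the cells of ONE slice over a family of boxes: `Σ_Δ Sχ_ΔS = S(Σ_Δ χ_Δ)S`.
[cite: MagnenRivasseauSeneor1993, Sect. IV (IV.6)–(IV.9) p.355] -/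
theorem sum_cellOp {β : Type*} (s : Finset β) (S : E →L[𝕜] E) (χ : β → E →L[𝕜] E) :
    ∑ Δ ∈ s, cellOp S (χ Δ) = S * (∑ Δ ∈ s, χ Δ) * S := by
  simp only [cellOp, Finset.mul_sum, Finset.sum_mul]

end cell

/-! ## §3 (IV.6)–(IV.9): the data, the pieces, their positivity and their sum -/

section pieces

variable (𝕜 E : Type*) [RCLike 𝕜] [NormedAddCommGroup E] [InnerProductSpace 𝕜 E] [CompleteSpace E]

/-- The data of (IV.7)–(IV.9): slices `j : J` (the paper's `j ∈ 𝐏`), for each the finite set of boxes of the lattice `𝐃_j`,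
the self-adjoint square roots `(κ^j)^{1∕2}` and the positive box operators `χ_Δ` with `Σ_{Δ∈𝐃_j} χ_Δ = 1` (the boxes of `𝐃_j`
tile the finite volume). Readings (β), (δ) of the module docstring. [cite: MagnenRivasseauSeneor1993, Sect. IV (IV.7)–(IV.9)
p.355; (II.15) p.331; 𝐃_j p.335] -/
structure SliceLocalization (J β : Type*) where
  /-- the boxes of `𝐃_j` (a finite set: finite volume) -/
  boxes : J → Finset β
  /-- `(κ^j)^{1∕2}` -/
  sqrtSlice : J → E →L[𝕜] E
  /-- `(κ^j)^{1∕2}` is self-adjoint (a real symbol) -/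
  sqrtSlice_selfAdjoint : ∀ j, IsSelfAdjoint (sqrtSlice j)
  /-- `χ_Δ` -/
  chi : β → E →L[𝕜] E
  /-- `χ_Δ` is a positive operator (an indicator) -/
  chi_pos : ∀ Δ, (chi Δ).IsPositive
  /-- the boxes of `𝐃_j` tile `Λ`: `Σ_{Δ∈𝐃_j} χ_Δ = 1` -/
  sum_chi : ∀ j, ∑ Δ ∈ boxes j, chi Δ = 1

variable {𝕜 E} {J β : Type*} (d : SliceLocalization 𝕜 E J β)

namespace SliceLocalization

/-- The slice operator `κ^j = (κ^j)^{1∕2}(κ^j)^{1∕2}`. [cite: MagnenRivasseauSeneor1993, (II.15) p.331; Sect. IV (IV.7) p.355] -/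
def slice (j : J) : E →L[𝕜] E := d.sqrtSlice j * d.sqrtSlice j

/-- `κ^j` is a positive operator. [cite: MagnenRivasseauSeneor1993, (II.15) p.331] -/
theorem isPositive_slice (j : J) : (d.slice j).IsPositive := by
  have h := ContinuousLinearMap.isPositive_self_comp_adjoint (d.sqrtSlice j)
  rw [(d.sqrtSlice_selfAdjoint j).adjoint_eq] at h
  rw [slice, ContinuousLinearMap.mul_def]
  exact h

/-- `⟪F, κ^j F⟫ = ‖(κ^j)^{1∕2} F‖²`. [cite: MagnenRivasseauSeneor1993, (II.15) p.331; Sect. IV (IV.7) p.355] -/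
theorem inner_slice (j : J) (F : E) : ⟪F, d.slice j F⟫_𝕜 = ((‖d.sqrtSlice j F‖ : 𝕜)) ^ 2 := by
  have h1 : d.slice j F = d.sqrtSlice j (d.sqrtSlice j F) := rfl
  rw [h1, ← ContinuousLinearMap.adjoint_inner_left (d.sqrtSlice j) _ F, (d.sqrtSlice_selfAdjoint j).adjoint_eq,
    inner_self_eq_norm_sq_to_K]

/-- All cells of one slice resum to the slice: `Σ_{Δ∈𝐃_j} (κ^j)^{1∕2}χ_Δ(κ^j)^{1∕2} = κ^j` (by `Σ_{Δ∈𝐃_j} χ_Δ = 1`).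
[cite: MagnenRivasseauSeneor1993, Sect. IV (IV.6)–(IV.9) p.355] -/
theorem sum_cellOp_boxes (j : J) : ∑ Δ ∈ d.boxes j, cellOp (d.sqrtSlice j) (d.chi Δ) = d.slice j := by
  rw [sum_cellOp, d.sum_chi j, mul_one, slice]

variable [Fintype J]

/-- The piece of `F²` carried by the cells labelled `X`, for ANY labelling `reg j Δ` of the cells `(j, Δ)` by a label set `L`:
`Σ_j Σ_{Δ∈𝐃_j, reg j Δ = X} (κ^j)^{1∕2} χ_Δ (κ^j)^{1∕2}` — *«an index like CSFR, LFR, BR etc. is a short notation for a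
decomposition of the type (IV.6–9)»*. [cite: MagnenRivasseauSeneor1993, Sect. IV (IV.7)–(IV.9) p.355 tl.26–27] -/
def pieceOp {L : Type*} [DecidableEq L] (reg : J → β → L) (X : L) : E →L[𝕜] E :=
  ∑ j, ∑ Δ ∈ (d.boxes j).filter (fun Δ => reg j Δ = X), cellOp (d.sqrtSlice j) (d.chi Δ)

/-- (IV.7): *«F²(A′)_CSFR ≡ Σ_j Σ_{Δ∈CSFR_j} F_μν (κ^j)^{1∕2} χ_Δ (κ^j)^{1∕2} F_μν»* — the operator between the two `F_μν`'s.
[cite: MagnenRivasseauSeneor1993, Sect. IV (IV.7) p.355] -/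
def F2CSFR (reg : J → β → Region) : E →L[𝕜] E := d.pieceOp reg Region.CSFR

/-- (IV.8): *«F²(A′)_LFR ≡ Σ_j Σ_{Δ∈LFR_j} F_μν (κ^j)^{1∕2} χ_Δ (κ^j)^{1∕2} F_μν»*.
[cite: MagnenRivasseauSeneor1993, Sect. IV (IV.8) p.355] -/
def F2LFR (reg : J → β → Region) : E →L[𝕜] E := d.pieceOp reg Region.LFR

/-- (IV.9): *«F²(A′)_BR ≡ Σ_j Σ_{Δ∈BR_j} F_μν (κ^j)^{1∕2} χ_Δ (κ^j)^{1∕2} F_μν»*.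
[cite: MagnenRivasseauSeneor1993, Sect. IV (IV.9) p.355] -/
def F2BR (reg : J → β → Region) : E →L[𝕜] E := d.pieceOp reg Region.BR

/-- **«in a way which respects the positivity of each piece»** — every piece, for every labelling, is a positive operator.
[cite: MagnenRivasseauSeneor1993, Sect. IV p.355 tl.20–21] -/
theorem isPositive_pieceOp {L : Type*} [DecidableEq L] (reg : J → β → L) (X : L) : (d.pieceOp reg X).IsPositive :=
  ContinuousLinearMap.isPositive_sum _ fun j _ =>
    ContinuousLinearMap.isPositive_sum _ fun Δ _ => isPositive_cellOp (d.sqrtSlice_selfAdjoint j) (d.chi_pos Δ)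

/-- The quadratic expression of each piece is nonnegative for every `F`. [cite: MagnenRivasseauSeneor1993, Sect. IV p.355
tl.20–21] -/
theorem inner_pieceOp_nonneg {L : Type*} [DecidableEq L] (reg : J → β → L) (X : L) (F : E) :
    0 ≤ ⟪F, d.pieceOp reg X F⟫_𝕜 :=
  (d.isPositive_pieceOp reg X).inner_nonneg_right F

/-- (IV.7) is positive. [cite: MagnenRivasseauSeneor1993, Sect. IV (IV.7) p.355 tl.20–21] -/
theorem isPositive_F2CSFR (reg : J → β → Region) : (d.F2CSFR reg).IsPositive := d.isPositive_pieceOp reg _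

/-- (IV.8) is positive. [cite: MagnenRivasseauSeneor1993, Sect. IV (IV.8) p.355 tl.20–21] -/
theorem isPositive_F2LFR (reg : J → β → Region) : (d.F2LFR reg).IsPositive := d.isPositive_pieceOp reg _

/-- (IV.9) is positive — *«F², which is treated as an interaction, remains positive»* in BR.
[cite: MagnenRivasseauSeneor1993, Sect. IV (IV.9) p.355 tl.14–15, tl.20–21] -/
theorem isPositive_F2BR (reg : J → β → Region) : (d.F2BR reg).IsPositive := d.isPositive_pieceOp reg _

/-- **The «more generally» sentence**: for ANY finite label set, the pieces resum to `Σ_j κ^j`.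
[cite: MagnenRivasseauSeneor1993, Sect. IV (IV.6) p.355 tl.26–27] -/
theorem sum_pieceOp {L : Type*} [Fintype L] [DecidableEq L] (reg : J → β → L) :
    ∑ X, d.pieceOp reg X = ∑ j, d.slice j := by
  unfold pieceOp
  rw [Finset.sum_comm]
  refine Finset.sum_congr rfl fun j _ => ?_
  rw [Finset.sum_fiberwise (d.boxes j) (reg j) (fun Δ => cellOp (d.sqrtSlice j) (d.chi Δ))]
  exact d.sum_cellOp_boxes j

/-- **(IV.6)**, operator form: `F²_CSFR + F²_LFR + F²_BR = Σ_j κ^j`. [cite: MagnenRivasseauSeneor1993, Sect. IV (IV.6) p.355] -/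
theorem display_IV6 (reg : J → β → Region) : d.F2CSFR reg + d.F2LFR reg + d.F2BR reg = ∑ j, d.slice j := by
  rw [← d.sum_pieceOp reg, Region.sum_univ]
  rfl

/-- (IV.6), quadratic form: `⟪F, (F²_CSFR + F²_LFR + F²_BR) F⟫ = Σ_j ‖(κ^j)^{1∕2} F‖²`.
[cite: MagnenRivasseauSeneor1993, Sect. IV (IV.6) p.355] -/
theorem inner_display_IV6 (reg : J → β → Region) (F : E) :
    ⟪F, (d.F2CSFR reg + d.F2LFR reg + d.F2BR reg) F⟫_𝕜 = ∑ j, ((‖d.sqrtSlice j F‖ : 𝕜)) ^ 2 := by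
  rw [d.display_IV6 reg, _root_.sum_apply, inner_sum]
  exact Finset.sum_congr rfl fun j _ => d.inner_slice j F

/-- Each piece is below the total in the Loewner order (the other pieces are positive).
[cite: MagnenRivasseauSeneor1993, Sect. IV (IV.6) p.355 tl.20–21] -/
theorem pieceOp_le_total {L : Type*} [Fintype L] [DecidableEq L] (reg : J → β → L) (X : L) :
    d.pieceOp reg X ≤ ∑ j, d.slice j := by
  rw [ContinuousLinearMap.le_def, ← d.sum_pieceOp reg, ← Finset.sum_erase_add _ _ (Finset.mem_univ X), add_sub_cancel_right]
  exact ContinuousLinearMap.isPositive_sum _ fun Y _ => d.isPositive_pieceOp reg Y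

/-- **(IV.6) at the level of the printed sentence**: when the slices carry the field, `(Σ_j κ^j) F = F`, the three displayed
expressions add up to `F² = ⟪F, F⟫`. Reading (γ). [cite: MagnenRivasseauSeneor1993, Sect. IV (IV.6) p.355] -/
theorem display_IV6_of_carried (reg : J → β → Region) {F : E} (hF : (∑ j, d.slice j) F = F) :
    ⟪F, F⟫_𝕜 = ⟪F, d.F2CSFR reg F⟫_𝕜 + ⟪F, d.F2LFR reg F⟫_𝕜 + ⟪F, d.F2BR reg F⟫_𝕜 := by
  rw [← inner_add_right, ← inner_add_right, ← _root_.add_apply, ← _root_.add_apply, d.display_IV6 reg, hF]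

/-- The defect of (IV.6) in general: `⟪F, F⟫ − (F²_CSFR + F²_LFR + F²_BR)(F) = ⟪F, (1 − Σ_j κ^j) F⟫` — zero iff the slices
carry `F`. Reading (γ): exhibited, not adjudicated. [cite: MagnenRivasseauSeneor1993, Sect. IV (IV.6) p.355] -/
theorem display_IV6_defect (reg : J → β → Region) (F : E) :
    ⟪F, F⟫_𝕜 - ⟪F, (d.F2CSFR reg + d.F2LFR reg + d.F2BR reg) F⟫_𝕜 = ⟪F, (1 - ∑ j, d.slice j) F⟫_𝕜 := by
  rw [d.display_IV6 reg, _root_.sub_apply, one_apply_eq_self, inner_sub_right]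

/-- With the printed rule of §1: the LFR piece collects exactly the cells whose box lies in `LFR_j`.
[cite: MagnenRivasseauSeneor1993, Sect. IV (IV.8) p.355 tl.3–7] -/
theorem F2LFR_regionOf [DecidableEq β] (LFR ELFR : J → Finset β) :
    d.F2LFR (fun j => regionOf (LFR j) (ELFR j)) = ∑ j, ∑ Δ ∈ d.boxes j ∩ LFR j, cellOp (d.sqrtSlice j) (d.chi Δ) := by
  unfold F2LFR pieceOp
  refine Finset.sum_congr rfl fun j _ => Finset.sum_congr ?_ fun _ _ => rfl
  ext Δ
  simp [Finset.mem_filter, regionOf_eq_LFR_iff]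

/-- … the BR piece the cells of «ELFR–LFR» … [cite: MagnenRivasseauSeneor1993, Sect. IV (IV.9) p.355 tl.6–7] -/
theorem F2BR_regionOf [DecidableEq β] (LFR ELFR : J → Finset β) :
    d.F2BR (fun j => regionOf (LFR j) (ELFR j)) =
      ∑ j, ∑ Δ ∈ d.boxes j ∩ (ELFR j \ LFR j), cellOp (d.sqrtSlice j) (d.chi Δ) := by
  unfold F2BR pieceOp
  refine Finset.sum_congr rfl fun j _ => Finset.sum_congr ?_ fun _ _ => rfl
  ext Δ
  simp only [Finset.mem_filter, regionOf_eq_BR_iff, Finset.mem_inter]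

/-- … and the CSFR piece the cells off `ELFR_j` (given `LFR_j ⊆ ELFR_j`). [cite: MagnenRivasseauSeneor1993, Sect. IV (IV.7)
p.355 tl.4–5] -/
theorem F2CSFR_regionOf [DecidableEq β] {LFR ELFR : J → Finset β} (h : ∀ j, LFR j ⊆ ELFR j) :
    d.F2CSFR (fun j => regionOf (LFR j) (ELFR j)) = ∑ j, ∑ Δ ∈ d.boxes j \ ELFR j, cellOp (d.sqrtSlice j) (d.chi Δ) := by
  unfold F2CSFR pieceOp
  refine Finset.sum_congr rfl fun j _ => Finset.sum_congr ?_ fun _ _ => rfl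
  ext Δ
  simp only [Finset.mem_filter, regionOf_eq_CSFR_iff (h j), Finset.mem_sdiff]

end SliceLocalization

end pieces

/-! ## §4 Why the square roots: the naive localisation `χ_Δ κ^j` is NOT positive (kernel counterexample)

p.352 tl.38–39: *«We use a rather complicated symmetric way to extract them in order to preserve positivity as much as possible
(positivity is indeed essential for constructive estimates).»* — on two modes, the symmetric placement of (IV.7)–(IV.9) is positive
and the one-sided placement is not. -/

section whySquareRoots

/-- `κ`: the orthogonal projection of `ℚ²` on the diagonal `(1,1)` — symmetric, idempotent, hence positive and its own square
root (a two-mode «momentum slice»). [cite: MagnenRivasseauSeneor1993, Sect. IV (IV.7) p.355] -/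
def kex : Matrix (Fin 2) (Fin 2) ℚ := !![1/2, 1/2; 1/2, 1/2]

/-- `χ`: the coordinate projection `diag(1, 0)` (a two-point «box indicator»). [cite: MagnenRivasseauSeneor1993, Sect. IV
(IV.7) p.355] -/
def chex : Matrix (Fin 2) (Fin 2) ℚ := !![1, 0; 0, 0]

/-- The test vector `v = (1, −2)`. [cite: MagnenRivasseauSeneor1993, Sect. IV (IV.7) p.355] -/
def vex : Fin 2 → ℚ := ![1, -2]

/-- `κ` is symmetric. [cite: MagnenRivasseauSeneor1993, Sect. IV (IV.7) p.355] -/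
theorem kex_transpose : kex.transpose = kex := by
  ext i j; fin_cases i <;> fin_cases j <;> rfl

/-- `κ² = κ`: `κ` is its own square root. [cite: MagnenRivasseauSeneor1993, Sect. IV (IV.7) p.355] -/
theorem kex_mul_kex : kex * kex = kex := by
  ext i j; fin_cases i <;> fin_cases j <;> norm_num [kex, Matrix.mul_apply, Fin.sum_univ_two]

/-- `χ² = χ`, `χ` symmetric. [cite: MagnenRivasseauSeneor1993, Sect. IV (IV.7) p.355] -/
theorem chex_mul_chex : chex * chex = chex ∧ chex.transpose = chex := by
  constructor <;> ext i j <;> fin_cases i <;> fin_cases j <;> norm_num [chex, Matrix.mul_apply, Fin.sum_univ_two]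

/-- `κ` is positive: `vᵀκv = (v₀ + v₁)²∕2 ≥ 0`. [cite: MagnenRivasseauSeneor1993, Sect. IV (IV.7) p.355] -/
theorem kex_form_nonneg (v : Fin 2 → ℚ) : 0 ≤ v ⬝ᵥ kex.mulVec v := by
  have h : v ⬝ᵥ kex.mulVec v = (v 0 + v 1) ^ 2 / 2 := by
    simp [kex, Matrix.mulVec, dotProduct, Fin.sum_univ_two]; ring
  rw [h]; positivity

/-- `χ` is positive: `vᵀχv = v₀² ≥ 0`. [cite: MagnenRivasseauSeneor1993, Sect. IV (IV.7) p.355] -/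
theorem chex_form_nonneg (v : Fin 2 → ℚ) : 0 ≤ v ⬝ᵥ chex.mulVec v := by
  have h : v ⬝ᵥ chex.mulVec v = v 0 ^ 2 := by
    simp [chex, Matrix.mulVec, dotProduct, Fin.sum_univ_two]; ring
  rw [h]; positivity

/-- **The naive localisation is not positive**: `vᵀ(χκ)v = −1∕2` at `v = (1, −2)`.
[cite: MagnenRivasseauSeneor1993, Sect. IV p.355 tl.20–21] -/
theorem naive_form_neg : vex ⬝ᵥ (chex * kex).mulVec vex = -1/2 := by
  simp [kex, chex, vex, Matrix.mulVec, dotProduct, Fin.sum_univ_two, Matrix.mul_apply]; norm_num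

/-- Nor is its symmetrisation: `vᵀ((χκ + κχ)∕2)v = −1∕2` at `v = (1, −2)`.
[cite: MagnenRivasseauSeneor1993, Sect. IV p.355 tl.20–21] -/
theorem naiveSymm_form_neg : vex ⬝ᵥ ((1/2 : ℚ) • (chex * kex + kex * chex)).mulVec vex = -1/2 := by
  simp [kex, chex, vex, Matrix.mulVec, dotProduct, Fin.sum_univ_two]; norm_num

/-- **The printed sandwich is positive**: `vᵀ(κ^{1∕2}χκ^{1∕2})v = vᵀ(κχκ)v = (v₀ + v₁)²∕4 ≥ 0` for every `v`.
[cite: MagnenRivasseauSeneor1993, Sect. IV (IV.7)–(IV.9) p.355 tl.20–21] -/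
theorem sandwich_form_nonneg (v : Fin 2 → ℚ) : 0 ≤ v ⬝ᵥ (kex * chex * kex).mulVec v := by
  have h : v ⬝ᵥ (kex * chex * kex).mulVec v = (v 0 + v 1) ^ 2 / 4 := by
    simp [kex, chex, Matrix.mulVec, dotProduct, Fin.sum_univ_two, Matrix.mul_apply]; ring
  rw [h]; positivity

/-- At the test vector the sandwich gives `1∕4` where the naive placement gave `−1∕2`.
[cite: MagnenRivasseauSeneor1993, Sect. IV (IV.7) p.355] -/
theorem sandwich_form_vex : vex ⬝ᵥ (kex * chex * kex).mulVec vex = 1/4 := by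
  simp [kex, chex, vex, Matrix.mulVec, dotProduct, Fin.sum_univ_two, Matrix.mul_apply]; norm_num

end whySquareRoots

/-! ## §5 The symbols `(κ^j)^{1∕2}`: square roots of the tree's nonnegative slices (II.15) ∕ (II.21) -/

section symbols

open Ansatz

/-- `(κ^i)^{1∕2}` squared is `κ^i` — the slices (II.15) are nonnegative (`Ansatz.sliceCutoff_nonneg`, `M ≥ 1`, `|p| ≥ 0`).
[cite: MagnenRivasseauSeneor1993, (II.15) p.331; Sect. IV (IV.7) p.355] -/
theorem sqrt_sliceCutoff_sq (P : CutoffProfile) {η M : ℝ} (hη : 0 < η) (hM : 1 ≤ M) (i : ℕ) {r : ℝ} (hr : 0 ≤ r) :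
    Real.sqrt (sliceCutoff P η M i r) ^ 2 = sliceCutoff P η M i r :=
  Real.sq_sqrt (sliceCutoff_nonneg P η M hη hM i hr)

/-- `Σ_{i=0}^{ρ} ((κ^i)^{1∕2})² = κ_ρ`: the squares of the square roots telescope to the cutoff (II.13) (`Ansatz.sum_sliceCutoff`)
— the scalar content of `Σ_j κ^j` in Reading (γ). [cite: MagnenRivasseauSeneor1993, (II.13)–(II.15) p.331] -/
theorem sum_sqrt_sliceCutoff_sq (P : CutoffProfile) {η M : ℝ} (hη : 0 < η) (hM : 1 ≤ M) (ρ : ℕ) {r : ℝ} (hr : 0 ≤ r) :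
    ∑ i ∈ Finset.range (ρ + 1), Real.sqrt (sliceCutoff P η M i r) ^ 2 = scaledCutoff P η M ρ r := by
  rw [← sum_sliceCutoff]
  exact Finset.sum_congr rfl fun i _ => sqrt_sliceCutoff_sq P hη hM i hr

/-- `(κ^{i,α})^{1∕2}` squared is `κ^{i,α}` for the anisotropic slices `j = (i, α) ∈ 𝐏` of (II.21) over which `j` runs in Sect. IV
(mrs-lit-1's reading `Ansatz.anisoSlice`, `anisoSlice_nonneg`). [cite: MagnenRivasseauSeneor1993, (II.21a)–(II.21b) p.335;
Sect. IV (IV.7) p.355] -/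
theorem sqrt_anisoSlice_sq (P : CutoffProfile) {η M : ℝ} (hη : 0 < η) (hM : 1 ≤ M) (N i α : ℕ) {r r₀ : ℝ} (hr : 0 ≤ r)
    (hr₀ : 0 ≤ r₀) : Real.sqrt (anisoSlice P η M N i α r r₀) ^ 2 = anisoSlice P η M N i α r r₀ :=
  Real.sq_sqrt (anisoSlice_nonneg P η M hη hM N i α hr hr₀)

end symbols

end PositiveLocalization

end Literature.MathematicalPhysics.QuantumFieldTheory.MagnenRivasseauSeneor1993
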